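/-
Copyright (c) 2026 the pub-hodgecm-mathlib formalisation cell (harness21).  Prover seat hodgecm-mathlib-A-p03 (g25); (R2)-EP road of line «N6nsGerm» (chair F0P3a-plan (g10),
EP pen B-p04 (g34)), the generic residue-ring count asked for by B-p08 (g27) 08:17:40Z (type-(2) scalar-reduction strata, case `e = 0`), 2026-09-01.
FILE 6 of the story `UnramifiedQuadraticNorm*`.
-/
import Literature.NumberTheory.LocalFields.UnramifiedQuadraticNormQuadraticCount     -- ★ FILE 5: `natCard_antifixed_quotient_pow` (+ FILE 1 `natCard_fixed_quotient_pow`)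
import Literature.NumberTheory.LocalFields.UnramifiedQuadraticNormResidueShift       -- ★ `mem_maximalIdeal_pow_iff_pow_dvd`
import HarnessLib

/-!
# Fixed and anti-fixed classes of `σ̄` on `R ⧸ 𝔪^{k+1}` that VANISH modulo `𝔪`: there are `q^k` of each
# (Serre, *Local Fields* Ch. V §2; the `e = 0` kernel count of the type-(2) scalar-reduction strata, Flicker 1998 p. 97)

Topic `NumberTheory/LocalFields`, namespace `Literature.NumberTheory.LocalFields.UnramifiedQuadraticNorm` (FILE 6 of the story; FILE 1 = ★ `…FixedPoints`
`natCard_fixed_quotient_pow`, FILE 5 = ★ `…QuadraticCount` `natCard_antifixed_quotient_pow`).  THEOREMS ONLY: no definition, no named fact, no instance, no notation,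
no `sorry`; kernel lane.  HONEST LABEL: HC_CM is proved only modulo the printed citations until rung 0 closes; this file is finite commutative algebra.

THE MATHEMATICS.  `R` a complete discrete valuation ring with an involution `σ` moving some element by a unit and residue field of order `q²` (the integers of an
unramified quadratic extension `E∕F` of local fields), `p` a `σ`-FIXED uniformizer (`p ∈ F`).  Multiplication by `p` is an `R`-linear bijection
`R ⧸ 𝔪^k ≃ 𝔪 ⧸ 𝔪^{k+1} = 𝔪·(R ⧸ 𝔪^{k+1})` commuting with `σ̄` (because `σ p = p`), so for every `ε ∈ R`
**`natCard_smulFixed_mem_map_maximalIdeal_eq`**: `#{x ∈ R⧸𝔪^{k+1} : σ̄x = ε̄x, x ∈ 𝔪̄} = #{y ∈ R⧸𝔪^k : σ̄y = ε̄y}`; with `ε = 1` (★ FILE 1: `q^k` fixed classes) and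
`ε = −1` (★ FILE 5: `q^k` anti-fixed classes):
* **`natCard_fixed_quotient_pow_succ_mem_map`**, **`natCard_antifixed_quotient_pow_succ_mem_map`** — `q^k` each on `R ⧸ 𝔪^{k+1}`;
* **`natCard_fixed_quotient_pow_mem_map`**, **`natCard_antifixed_quotient_pow_mem_map`** — the `1 ≤ k` spelling, value `q^{k−1}`;
* `sum_Icc_pow_sub_one_eq_sum_range` — the bookkeeping `Σ_{1≤k≤N} q^{k−1} = Σ_{k<N} q^k`.
CONSUMER (B-p08 (g27) (R-a), type-(2) elliptic edge count on the tree of `U(Φ₂)_v`): in the parity `e = 0` the `γ`-stable self-dual Hermite lattices of the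
stratum `k ≥ 1` on which `γ` reduces to a SCALAR are parametrised by the anti-fixed classes `z̄ mod 𝔪^k` with `ϖ ∣ z` — `q^{k−1}` of them; summed, `Σ_{k<N} q^k`
interior vertices.

## References
* [Serre1979] J.-P. Serre, *Local Fields*, GTM 67 (1979), Ch. V §2 Prop. 2–3.
* [Flicker1998UnitaryFL] Y. Z. Flicker, *Elementary proof of the fundamental lemma for a unitary group*, Canad. J. Math. 50 (1998): §6 p. 95 REMARK, p. 97.
* [Kottwitz1988] R. E. Kottwitz, *Tamagawa numbers*, Ann. of Math. 127 (1988): §2.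
-/

set_option autoImplicit false

namespace Literature.NumberTheory.LocalFields.UnramifiedQuadraticNorm

open IsLocalRing

universe u

variable {R : Type u} [CommRing R] (σ : R →+* R) [IsDomain R] [IsDiscreteValuationRing R] (hσ : ∀ a, σ (σ a) = a)

/-! ## §1 Multiplication by a `σ`-fixed uniformizer: `{σ̄ = ε̄·} ⊆ R⧸𝔪^k` ≃ `{σ̄ = ε̄·} ∩ 𝔪̄ ⊆ R⧸𝔪^{k+1}` -/

include hσ in
/-- **`#{x ∈ R⧸𝔪^{k+1} : σ̄x = ε̄·x, x ∈ 𝔪̄} = #{y ∈ R⧸𝔪^k : σ̄y = ε̄·y}`** for a `σ`-fixed uniformizer `p` and any `ε ∈ R`: `y = r̄ ↦ x = p·r mod 𝔪^{k+1}` is well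
defined and injective (`p r ∈ 𝔪^{k+1} ⟺ r ∈ 𝔪^k`), onto the classes vanishing mod `𝔪 = (p)`, and `σ̄(p̄ r̄) = p̄ σ̄(r̄)`. [cite: Serre1979, Ch. V §2 Prop. 2–3] -/
theorem natCard_smulFixed_mem_map_maximalIdeal_eq {p : R} (hp : Irreducible p) (hσp : σ p = p) (ε : R) (k : ℕ) :
    Nat.card {x : R ⧸ maximalIdeal R ^ (k + 1) //
        Ideal.quotientMap (maximalIdeal R ^ (k + 1)) σ (maximalIdeal_pow_le_comap σ hσ (k + 1)) x = Ideal.Quotient.mk (maximalIdeal R ^ (k + 1)) ε * x ∧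
          x ∈ (maximalIdeal R).map (Ideal.Quotient.mk (maximalIdeal R ^ (k + 1)))} =
      Nat.card {y : R ⧸ maximalIdeal R ^ k //
        Ideal.quotientMap (maximalIdeal R ^ k) σ (maximalIdeal_pow_le_comap σ hσ k) y = Ideal.Quotient.mk (maximalIdeal R ^ k) ε * y} := by
  classical
  have hm : maximalIdeal R = Ideal.span {p} := (IsDiscreteValuationRing.irreducible_iff_uniformizer p).1 hp
  -- divisibility dictionary: `p r ∈ 𝔪^{k+1} ⟺ r ∈ 𝔪^k`
  have hpk : ∀ r : R, p * r ∈ maximalIdeal R ^ (k + 1) ↔ r ∈ maximalIdeal R ^ k := fun r => by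
    rw [mem_maximalIdeal_pow_iff_pow_dvd hp, mem_maximalIdeal_pow_iff_pow_dvd hp, pow_succ', mul_dvd_mul_iff_left hp.ne_zero]
  -- the map `r̄ ↦ p·r mod 𝔪^{k+1}`
  have hle : maximalIdeal R ^ k ≤ Submodule.comap (LinearMap.mulLeft R p) (maximalIdeal R ^ (k + 1)) := fun r hr => by
    rw [Submodule.mem_comap, LinearMap.mulLeft_apply]
    exact (hpk r).2 hr
  set f : R ⧸ maximalIdeal R ^ k →ₗ[R] R ⧸ maximalIdeal R ^ (k + 1) := Submodule.mapQ _ _ (LinearMap.mulLeft R p) hle with hfdef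
  have hf : ∀ r : R, f (Ideal.Quotient.mk _ r) = Ideal.Quotient.mk _ (p * r) := fun r => rfl
  set σk := Ideal.quotientMap (maximalIdeal R ^ k) σ (maximalIdeal_pow_le_comap σ hσ k) with hσkdef
  set σk1 := Ideal.quotientMap (maximalIdeal R ^ (k + 1)) σ (maximalIdeal_pow_le_comap σ hσ (k + 1)) with hσk1def
  -- injective
  have hinj : Function.Injective f := by
    intro y₁ y₂ h
    obtain ⟨r₁, rfl⟩ := Ideal.Quotient.mk_surjective y₁
    obtain ⟨r₂, rfl⟩ := Ideal.Quotient.mk_surjective y₂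
    rw [hf, hf, Ideal.Quotient.eq, ← mul_sub, hpk] at h
    exact (Ideal.Quotient.eq).2 h
  -- commutes with `σ̄`, and with multiplication by `ε̄`
  have hσf : ∀ y, σk1 (f y) = f (σk y) := by
    intro y
    obtain ⟨r, rfl⟩ := Ideal.Quotient.mk_surjective y
    rw [hf, hσk1def, quotientMap_mk σ hσ, hσkdef, quotientMap_mk σ hσ, hf, map_mul, hσp]
  have hεf : ∀ y, Ideal.Quotient.mk _ ε * f y = f (Ideal.Quotient.mk _ ε * y) := by
    intro y
    obtain ⟨r, rfl⟩ := Ideal.Quotient.mk_surjective y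
    rw [← map_mul, hf, hf, ← map_mul]
    exact congrArg _ (by ring)
  -- image = the classes vanishing mod `𝔪`
  have hmem : ∀ y, f y ∈ (maximalIdeal R).map (Ideal.Quotient.mk (maximalIdeal R ^ (k + 1))) := by
    intro y
    obtain ⟨r, rfl⟩ := Ideal.Quotient.mk_surjective y
    rw [hf]
    exact Ideal.mem_map_of_mem _ (by rw [hm]; exact Ideal.mul_mem_right _ _ (Ideal.mem_span_singleton_self p))
  have hsurj : ∀ x : R ⧸ maximalIdeal R ^ (k + 1), x ∈ (maximalIdeal R).map (Ideal.Quotient.mk (maximalIdeal R ^ (k + 1))) → ∃ y, f y = x := by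
    intro x hx
    obtain ⟨s, hs, rfl⟩ := (Ideal.mem_map_iff_of_surjective _ Ideal.Quotient.mk_surjective).1 hx
    rw [hm] at hs
    obtain ⟨r, rfl⟩ := Ideal.mem_span_singleton'.1 hs
    exact ⟨Ideal.Quotient.mk _ r, by rw [hf, mul_comm]⟩
  -- the bijection between the two subtypes
  symm
  refine Nat.card_congr (Equiv.ofBijective
    (fun y => (⟨f y.1, ⟨by rw [hσf, y.2, hεf], hmem y.1⟩⟩ : {x : R ⧸ maximalIdeal R ^ (k + 1) //
        σk1 x = Ideal.Quotient.mk (maximalIdeal R ^ (k + 1)) ε * x ∧ x ∈ (maximalIdeal R).map (Ideal.Quotient.mk (maximalIdeal R ^ (k + 1)))}))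
    ⟨fun y₁ y₂ h => Subtype.ext (hinj (congrArg Subtype.val h)), fun x => ?_⟩)
  obtain ⟨y, hy⟩ := hsurj x.1 x.2.2
  refine ⟨⟨y, hinj ?_⟩, Subtype.ext hy⟩
  rw [← hσf, ← hεf, hy]
  exact x.2.1

/-! ## §2 The counts: `q^k` fixed and `q^k` anti-fixed classes of `R ⧸ 𝔪^{k+1}` vanish mod `𝔪` -/

section Counts

variable {a : R} (ha : IsUnit (σ a - a)) {q : ℕ} (hq : Nat.card (ResidueField R) = q ^ 2) {p : R} (hp : Irreducible p) (hσp : σ p = p)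

include hσ ha hq hp hσp in
/-- **`#{x ∈ R⧸𝔪^{k+1} : σ̄x = x, x ∈ 𝔪̄} = q^k`** (§1 at `ε = 1` + ★ `natCard_fixed_quotient_pow`). [cite: Serre1979, Ch. V §2 Prop. 2–3] -/
theorem natCard_fixed_quotient_pow_succ_mem_map (k : ℕ) :
    Nat.card {x : R ⧸ maximalIdeal R ^ (k + 1) //
        Ideal.quotientMap (maximalIdeal R ^ (k + 1)) σ (maximalIdeal_pow_le_comap σ hσ (k + 1)) x = x ∧
          x ∈ (maximalIdeal R).map (Ideal.Quotient.mk (maximalIdeal R ^ (k + 1)))} = q ^ k := by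
  have h := natCard_smulFixed_mem_map_maximalIdeal_eq σ hσ hp hσp 1 k
  simp only [map_one, one_mul] at h
  rw [h]
  exact natCard_fixed_quotient_pow σ hσ ha hq k

include hσ ha hq hp hσp in
/-- **`#{x ∈ R⧸𝔪^{k+1} : σ̄x = −x, x ∈ 𝔪̄} = q^k`** (§1 at `ε = −1` + ★ `natCard_antifixed_quotient_pow`) — the anti-fixed classes `z̄ mod 𝔪^{k+1}` with `ϖ ∣ z`.
[cite: Serre1979, Ch. V §2 Prop. 2–3] [cite: Flicker1998UnitaryFL, §6 p. 97] -/
theorem natCard_antifixed_quotient_pow_succ_mem_map (k : ℕ) :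
    Nat.card {x : R ⧸ maximalIdeal R ^ (k + 1) //
        Ideal.quotientMap (maximalIdeal R ^ (k + 1)) σ (maximalIdeal_pow_le_comap σ hσ (k + 1)) x = -x ∧
          x ∈ (maximalIdeal R).map (Ideal.Quotient.mk (maximalIdeal R ^ (k + 1)))} = q ^ k := by
  have h := natCard_smulFixed_mem_map_maximalIdeal_eq σ hσ hp hσp (-1) k
  simp only [map_neg, map_one, neg_mul, one_mul] at h
  rw [h]
  exact natCard_antifixed_quotient_pow σ hσ ha hq k

include hσ ha hq hp hσp in
/-- The `1 ≤ k` spelling: **`#{x ∈ R⧸𝔪^k : σ̄x = x, x ∈ 𝔪̄} = q^{k−1}`**. [cite: Serre1979, Ch. V §2 Prop. 2–3] -/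
theorem natCard_fixed_quotient_pow_mem_map {k : ℕ} (hk : 1 ≤ k) :
    Nat.card {x : R ⧸ maximalIdeal R ^ k //
        Ideal.quotientMap (maximalIdeal R ^ k) σ (maximalIdeal_pow_le_comap σ hσ k) x = x ∧
          x ∈ (maximalIdeal R).map (Ideal.Quotient.mk (maximalIdeal R ^ k))} = q ^ (k - 1) := by
  obtain ⟨j, rfl⟩ : ∃ j, k = j + 1 := ⟨k - 1, by omega⟩
  rw [natCard_fixed_quotient_pow_succ_mem_map σ hσ ha hq hp hσp j, Nat.add_sub_cancel]

include hσ ha hq hp hσp in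
/-- The `1 ≤ k` spelling: **`#{x ∈ R⧸𝔪^k : σ̄x = −x, x ∈ 𝔪̄} = q^{k−1}`** — B-p08 (g27)'s kernel count for the type-(2) scalar-reduction strata (`e = 0`).
[cite: Serre1979, Ch. V §2 Prop. 2–3] [cite: Flicker1998UnitaryFL, §6 p. 97] -/
theorem natCard_antifixed_quotient_pow_mem_map {k : ℕ} (hk : 1 ≤ k) :
    Nat.card {x : R ⧸ maximalIdeal R ^ k //
        Ideal.quotientMap (maximalIdeal R ^ k) σ (maximalIdeal_pow_le_comap σ hσ k) x = -x ∧
          x ∈ (maximalIdeal R).map (Ideal.Quotient.mk (maximalIdeal R ^ k))} = q ^ (k - 1) := by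
  obtain ⟨j, rfl⟩ : ∃ j, k = j + 1 := ⟨k - 1, by omega⟩
  rw [natCard_antifixed_quotient_pow_succ_mem_map σ hσ ha hq hp hσp j, Nat.add_sub_cancel]

end Counts

/-! ## §3 Bookkeeping: `Σ_{1 ≤ k ≤ N} q^{k−1} = Σ_{k < N} q^k` -/

omit [IsDomain R] [IsDiscreteValuationRing R] in
/-- `Σ_{k ∈ [1, N]} q^{k−1} = Σ_{k < N} q^k` (re-indexing the interior-vertex count). [cite: Kottwitz1988, §2] -/
theorem sum_Icc_pow_sub_one_eq_sum_range (q N : ℕ) :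
    ∑ k ∈ Finset.Icc 1 N, q ^ (k - 1) = ∑ k ∈ Finset.range N, q ^ k := by
  induction N with
  | zero => simp
  | succ n ih =>
    rw [Finset.sum_Icc_succ_top (by omega), ih, Finset.sum_range_succ, Nat.add_sub_cancel]

end Literature.NumberTheory.LocalFields.UnramifiedQuadraticNorm
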